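/-
Copyright: cell pub-balaban-gaps (YM BLITZ Y1, track G1), seat g1-p2 GEN 8 (unit `pub-balaban-gaps-g1-p2`).  Row (D4) NODE O,
JUNCTION J-3 (multi-level), LEVEL-WEIGHTED LETTERS: the weight `w(x) = L^{k−lev(x)} = (L^{lev}η)^{−1}` on the fine torus of [4]'s nested
family, its neighbour ratio `Λ = L` ((2.2): torus neighbours' levels differ by ≤ 1), and the LEVEL-WEIGHTED letters of [4] Prop. 2.2 read
through the ROW form of the junction: `‖(w² ⊗ 1)(W ⊗ 1)‖ ≤ Ce^{−δ₁d₁}`, `‖(w ⊗ 1)(∇c_μ ⊗ 1)(W ⊗ 1)‖ ≤ Ce^{−δ₁d₁}` — print's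
«O(1)[(L^jη)², (L^jη)]» of (3.42) EXACTLY.  HONEST FRAMING: the flat operator is the lineage's scalar model; (D4) NOT discharged
(instance 0∕1); NOT BetaPertH, NOT continuum, NOT Clay.
-/
import Summits.QuantumFields.BalabanUV.Gaps.D4WalkBlockCovariantKernelMultiLevel
import Summits.QuantumFields.BalabanUV.Gaps.D4WalkBlockShiftWeighted

/-!
# `Gaps.D4WalkBlockWeightedLettersMultiLevel` — the level weight `L^{k − lev}` and the level-weighted letters of the multi-level flat
# propagator (cell pub-balaban-gaps, seat g1-p2 gen 8)

HONEST DEPENDENCY (cell pub-balaban, verbatim): continuum YM on T⁴ ⇐ BetaPertH ∧ nine spine estimates (0/9 proved);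
BetaPertH ⇐ (D1) ∧ (D4) ∧ CAP+tail.

* §1 the level weight `levW D x = L^{k − lev(x)}` (= `(L^{lev x}η)^{−1}`, `η = L^{−k}`): positivity, **`lev_le_succ_of_near`** (torus
  neighbours' levels differ by ≤ 1 — (2.2) `sepT` with `R·M ≥ 1`), `torusSupNorm_sub_tshift_symm_le_one`, **`levW_le_mul_tshift_symm`**
  (neighbour ratio `Λ = L`);
* §2 `wOp_mul_blockDiagonal` (weights act through the site factor), `blockNorm_rowWeighted_le` (the ROW form of 68's junction with a
  per-site weight), **`weightedLetters_multiLevelTorus`**: ∃ `δ₁, C, M₀, N₀` (d, ℓ, windows) such that for every admissible datum the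
  kernel `W ⊗ 1` (`W = η²(G′.map ofReal)`) carries the value letter `Ce^{−δ₁d₁}` AND the LEVEL-WEIGHTED letters
  `‖(w² ⊗ 1)(W ⊗ 1)‖_{Y,Y′} ≤ Ce^{−δ₁d₁}`, `‖(w ⊗ 1)(∇c_μ ⊗ 1)(W ⊗ 1)‖_{Y,Y′} ≤ Ce^{−δ₁d₁}` — from
  `prop22_first∕second_multiLevelTorus` (`F(y) = C_aL^{2j}`, `C_bL^{j}`) through `rowSum_le_of_hasMajorant` with `w(x)²·L^{2lev−2k}`,
  `w(x)·L^{lev−k}` ≡ 1: print's «O(1)[(L^jη)², (L^jη)]» EXACTLY, not bounded above by the top scale.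
WHAT IT IS NOT.  A construction of Bałaban's covariant objects; (D4) instance 0∕1.  Consumer: `D4WalkBlockCovariantWeightedMultiLevel`.

References: T. Bałaban, Comm. Math. Phys. **99** (1985) 389–434 [B9], (3.37) p. 396, Thm 3.1 (3.42) p. 397; Comm. Math. Phys. **96**
(1984) [4], (2.2) p. 224, Prop. 2.2 (2.67) p. 234, Lemma 2.1 (2.61) p. 234.
-/

noncomputable section

namespace Summit.QuantumFields.BalabanUV.Gaps.D4WalkBlockWeightedLettersMultiLevel

open Finset Metric
open scoped Matrix
open Literature.MathematicalPhysics.QuantumFieldTheory.Balaban1983to89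
open Literature.MathematicalPhysics.QuantumFieldTheory.Balaban1983to89.B4Reflection242 (boxDom mem_boxDom)
open Literature.MathematicalPhysics.QuantumFieldTheory.Balaban1983to89.B4ContourShift (supNorm)
open Literature.MathematicalPhysics.QuantumFieldTheory.Balaban1983to89.B4TorusKernel.MultiPeriod (torusSupNorm torusSupNorm_le_supNorm
  torusSupNorm_translate translate)
open Literature.MathematicalPhysics.QuantumFieldTheory.Balaban1983to89.B9SectDWalk (DomBy)
open Literature.MathematicalPhysics.QuantumFieldTheory.Balaban1983to89.B9Thm34Ext (toB6)
open Literature.MathematicalPhysics.QuantumFieldTheory.Balaban1983to89.B9Thm37GlueTorus (torusGeom tdist1 tdist1_nonneg)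
open Literature.MathematicalPhysics.QuantumFieldTheory.Balaban1983to89.TreeLengthTorus (TPt)
open Literature.MathematicalPhysics.QuantumFieldTheory.Balaban1983to89.B5TorusCover (UT)
open Literature.MathematicalPhysics.QuantumFieldTheory.Balaban1983to89.B11SectG (RowSum)
open Literature.MathematicalPhysics.QuantumFieldTheory.Balaban1983to89.B6MultiLevelBoxOperator (N0 bigSide one_le_bigSide)
open Literature.MathematicalPhysics.QuantumFieldTheory.Balaban1983to89.B6MultiLevelTorusOperator (TDomains gmlT tshift unitVec
  tshift_val_eq_translate tshift_symm_apply one_le_of_mem one_le_N0)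
open Literature.MathematicalPhysics.QuantumFieldTheory.Balaban1983to89.B6Geom246MultiLevelBox (bset blkOf blkOf_val scale_bounds)
open Literature.MathematicalPhysics.QuantumFieldTheory.Balaban1983to89.B6Geom246MultiLevelTorus (geomT lemma21_torus
  triangle_refl_nonneg_T torusSupNorm_neg)
open Literature.MathematicalPhysics.QuantumFieldTheory.Balaban1983to89.B6RandomWalk (HasMajorant hasMajorant_mono)
open Literature.MathematicalPhysics.QuantumFieldTheory.Balaban1983to89.B6Lemma21Repaired (Ineq261With)
open Literature.MathematicalPhysics.QuantumFieldTheory.Balaban1983to89.B6Ineq261LevelGap (K261 K261_nonneg theta_lt_one_of_log)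
open Literature.MathematicalPhysics.QuantumFieldTheory.Balaban1983to89.B6Ineq243TwoLevelBox (aNext)
open Literature.MathematicalPhysics.QuantumFieldTheory.Balaban1983to89.B6Prop22MultiLevelTorus (prop22_first_multiLevelTorus)
open Literature.MathematicalPhysics.QuantumFieldTheory.Balaban1983to89.B6Prop22DerivMultiLevelTorus (dT prop22_second_multiLevelTorus)
open Summit.QuantumFields.BalabanUV.Gaps.D4WalkBlock (blockNorm blockNorm_nonneg blockNorm_smul_le BlockWalkExpansion)
open Summit.QuantumFields.BalabanUV.Gaps.D4WalkBlockFlatLetters (blockNorm_map_ofReal_le map_ofReal_mul)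
open Summit.QuantumFields.BalabanUV.Gaps.D4WalkBlockFlatFibre (blockNorm_blockDiagonal_le)
open Summit.QuantumFields.BalabanUV.Gaps.D4WalkBlockMultiLevelGeometry (cubeML)
open Summit.QuantumFields.BalabanUV.Gaps.D4WalkBlockFlatLettersMultiLevel (rowSum_le_of_hasMajorant)
open Summit.QuantumFields.BalabanUV.Gaps.D4WalkBlockShiftAlgebra (fibD Dfw covShift)
open Summit.QuantumFields.BalabanUV.Gaps.D4WalkBlockShiftWeighted (wOp wOp_mul_apply covDopW covBW covAlphaW
  blockWalkExpansion_covShiftW_of_letters)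
open Summit.QuantumFields.BalabanUV.Gaps.D4WalkBlockCovariantShiftMultiLevel (tdist1_cubeML_tshift_symm_unitVec_le_one Dfw_tshift_eq)
open Summit.QuantumFields.BalabanUV.Gaps.D4WalkBlockCovariantKernelMultiLevel (blockDiagonal_smul_map_mul)

variable {d : ℕ}

/-! ## §1. The level weight `L^{k − lev}` and its neighbour ratio -/

section Weight

variable {ℓ Mh k R : ℕ} {P : Fin (d + 1) → ℕ} (D : TDomains d ℓ Mh k P R)

/-- **The level weight** `w(x) = L^{k − lev(x)} = (L^{lev x}η)^{−1}` (`η = L^{−k}`). [cite: Balaban1985BackgroundPropagators, (3.37) p.396, (3.61) p.402] -/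
def levW (x : ↥(boxDom (N0 ℓ Mh k P))) : ℝ := ((ℓ : ℝ) + 1) ^ (k - D.lev x.1)

variable {D}

/-- the level weight is positive. -/
theorem levW_pos (x : ↥(boxDom (N0 ℓ Mh k P))) : 0 < levW D x := by unfold levW; positivity

/-- `sup|e_μ| ≤ 1`. -/
theorem supNorm_unitVec_le (μ : Fin (d + 1)) : supNorm (unitVec μ : Fin (d + 1) → ℤ) ≤ 1 := by
  unfold supNorm
  refine Finset.sup'_le _ _ fun i _ => ?_
  unfold unitVec
  by_cases h : i = μ
  · subst h; simp
  · rw [Pi.single_eq_of_ne h]; simp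

/-- A unit translation is a torus neighbour: `|x − σ_{e_μ}⁻¹x|_T ≤ 1`. -/
theorem torusSupNorm_sub_tshift_symm_le_one (μ : Fin (d + 1)) (x : ↥(boxDom (N0 ℓ Mh k P))) :
    torusSupNorm (N0 ℓ Mh k P) (x.1 - ((tshift (N0 ℓ Mh k P) (unitVec μ)).symm x).1) ≤ 1 := by
  have hN : ∀ i, 1 ≤ N0 ℓ Mh k P i := one_le_of_mem x.2
  rw [tshift_symm_apply]
  obtain ⟨m, hm⟩ := tshift_val_eq_translate (N0 ℓ Mh k P) (-unitVec μ) x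
  have e : x.1 - (tshift (N0 ℓ Mh k P) (-unitVec μ) x).1 = translate (N0 ℓ Mh k P) (unitVec μ) (-m) := by
    rw [hm]; funext i
    simp only [Pi.sub_apply, Pi.add_apply, Pi.neg_apply, B4TorusKernel.MultiPeriod.translate_apply, unitVec]
    ring
  rw [e, torusSupNorm_translate]
  exact (torusSupNorm_le_supNorm hN _).trans (supNorm_unitVec_le μ)

/-- **TORUS NEIGHBOURS' LEVELS DIFFER BY AT MOST ONE** ((2.2): `dist_T(Ω_j^c, Ω_{j+1}) > R·M·L^j ≥ 1`, `R, M_h ≥ 1`).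
[cite: Balaban1984PropagatorsII, (2.2) p.224] -/
theorem lev_le_succ_of_near (hR : 1 ≤ R) (hMh : 1 ≤ Mh) (x x' : ↥(boxDom (N0 ℓ Mh k P)))
    (h : torusSupNorm (N0 ℓ Mh k P) (x.1 - x'.1) ≤ 1) : D.lev x'.1 ≤ D.lev x.1 + 1 := by
  by_contra hlt
  have hsep := D.sepT (D.lev x.1 + 1) x.1 x.2 x'.1 x'.2 (by omega) (by omega)
  have h1 : (1 : ℝ) ≤ ((R * bigSide ℓ Mh (D.lev x.1 + 1) : ℕ) : ℝ) := by
    have := Nat.mul_le_mul hR (one_le_bigSide (ℓ := ℓ) hMh (D.lev x.1 + 1))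
    exact_mod_cast (show 1 ≤ R * bigSide ℓ Mh (D.lev x.1 + 1) by simpa using this)
  linarith

/-- **NEIGHBOUR RATIO `Λ = L`**: `w(x) ≤ L·w(σ_{e_μ}⁻¹x)`. -/
theorem levW_le_mul_tshift_symm (hR : 1 ≤ R) (hMh : 1 ≤ Mh) (μ : Fin (d + 1)) (x : ↥(boxDom (N0 ℓ Mh k P))) :
    levW D x ≤ ((ℓ : ℝ) + 1) * levW D ((tshift (N0 ℓ Mh k P) (unitVec μ)).symm x) := by
  have hL1 : (1 : ℝ) ≤ (ℓ : ℝ) + 1 := by linarith [(Nat.cast_nonneg ℓ : (0 : ℝ) ≤ ℓ)]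
  have hlev := lev_le_succ_of_near (D := D) hR hMh x ((tshift (N0 ℓ Mh k P) (unitVec μ)).symm x)
    (torusSupNorm_sub_tshift_symm_le_one μ x)
  unfold levW
  rw [← pow_succ']
  exact pow_le_pow_right₀ hL1 (by omega)

end Weight

/-! ## §2. The level-weighted letters of the multi-level flat propagator -/

section Letters

variable {ℓ Mh k R : ℕ} {P : Fin (d + 1) → ℕ} {F : Type} [Fintype F] [DecidableEq F]

/-- weights act through the site factor: `(ω ⊗ 1)·((c·M) ⊗ 1) = ((x,x′) ↦ c·ω(x)M(x,x′)) ⊗ 1`. -/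
theorem wOp_mul_blockDiagonal (ω : ↥(boxDom (N0 ℓ Mh k P)) → ℝ) (c : ℂ) (M : Matrix ↥(boxDom (N0 ℓ Mh k P)) ↥(boxDom (N0 ℓ Mh k P)) ℝ) :
    wOp ↥(boxDom (N0 ℓ Mh k P)) F ω * Matrix.blockDiagonal (fun _ : F => c • M.map ((↑) : ℝ → ℂ)) =
      Matrix.blockDiagonal (fun _ : F => c • (Matrix.of fun x x' => ω x * M x x').map ((↑) : ℝ → ℂ)) := by
  ext p q
  rw [wOp_mul_apply, show p = (p.1, p.2) from rfl, show q = (q.1, q.2) from rfl, Matrix.blockDiagonal_apply,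
    Matrix.blockDiagonal_apply]
  simp only [Matrix.smul_apply, Matrix.map_apply, Matrix.of_apply, smul_eq_mul]
  split_ifs
  · push_cast; ring
  · rw [mul_zero]

/-- a ROW-weighted block letter from the row form of the junction: if `ω(x)·F(y(x)) ≤ Fw` for all `x` then
`‖((x,x′) ↦ ω(x)T(x,x′)).map ofReal‖_{Y,Y′} ≤ Fw·c₁·e^{−(½δ/(d+1))d₁}`. -/
theorem blockNorm_rowWeighted_le {D : TDomains d ℓ Mh k P R} {Kc : Fin (d + 1) → ℕ} [∀ i, NeZero (Kc i)] (hMh : 1 ≤ Mh)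
    (hP : ∀ μ, 1 ≤ P μ) (hKc : ∀ i, N0 ℓ Mh k P i = (ℓ + 1) ^ k * Kc i)
    (T : Matrix ↥(boxDom (N0 ℓ Mh k P)) ↥(boxDom (N0 ℓ Mh k P)) ℝ) {Fm : ↥(bset D.toDomains) → ℝ} {Fw δ c₁ : ℝ}
    (hδ : 0 ≤ δ) (hFw : 0 ≤ Fw) (hc₁ : 0 ≤ c₁) (hF0 : ∀ y, 0 ≤ Fm y) (ω : ↥(boxDom (N0 ℓ Mh k P)) → ℝ) (hω : ∀ x, 0 ≤ ω x)
    (hωF : ∀ x, ω x * Fm (blkOf D.toDomains x) ≤ Fw)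
    (hT : HasMajorant (g := geomT D) (blkOf D.toDomains) (Matrix.toLin' T)
      (fun y y' => Fm y * Real.exp (-(δ * (geomT D).dist y y'))))
    (h261 : Ineq261With c₁ (geomT D) δ (1 / 2)) (Y Y' : UT Kc) :
    blockNorm (fun x : ↥(boxDom (N0 ℓ Mh k P)) => cubeML ℓ k Kc x.1) (fun x : ↥(boxDom (N0 ℓ Mh k P)) => cubeML ℓ k Kc x.1)
        ((Matrix.of fun x x' => ω x * T x x').map ((↑) : ℝ → ℂ)) Y Y' ≤
      Fw * c₁ * Real.exp (-(δ / 2 / ((d : ℝ) + 1) * tdist1 Kc Y Y')) := by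
  refine blockNorm_map_ofReal_le _ _ _ Y Y' (by positivity) fun x hx => ?_
  have hrow := rowSum_le_of_hasMajorant (D := D) hMh hP hKc T hδ hF0 hT h261 Y Y' x hx
  calc ∑ x' ∈ Finset.univ.filter (fun x' : ↥(boxDom (N0 ℓ Mh k P)) => cubeML ℓ k Kc x'.1 = Y'),
        |(Matrix.of fun x x' => ω x * T x x') x x'|
      = ω x * ∑ x' ∈ Finset.univ.filter (fun x' : ↥(boxDom (N0 ℓ Mh k P)) => cubeML ℓ k Kc x'.1 = Y'), |T x x'| := by
        rw [Finset.mul_sum]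
        exact Finset.sum_congr rfl fun x' _ => by rw [Matrix.of_apply, abs_mul, abs_of_nonneg (hω x)]
    _ ≤ ω x * (Fm (blkOf D.toDomains x) * c₁ * Real.exp (-(δ / 2 / ((d : ℝ) + 1) * tdist1 Kc Y Y'))) :=
        mul_le_mul_of_nonneg_left hrow (hω x)
    _ ≤ Fw * c₁ * Real.exp (-(δ / 2 / ((d : ℝ) + 1) * tdist1 Kc Y Y')) := by
        rw [show ω x * (Fm (blkOf D.toDomains x) * c₁ * Real.exp (-(δ / 2 / ((d : ℝ) + 1) * tdist1 Kc Y Y'))) =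
          (ω x * Fm (blkOf D.toDomains x)) * c₁ * Real.exp (-(δ / 2 / ((d : ℝ) + 1) * tdist1 Kc Y Y')) by ring]
        exact mul_le_mul_of_nonneg_right (mul_le_mul_of_nonneg_right (hωF x) hc₁) (Real.exp_pos _).le

/-- a real scalar times a complexified real matrix is the complexification of the rescaled matrix. -/
theorem real_smul_of_mul_map (r : ℝ) (ω : ↥(boxDom (N0 ℓ Mh k P)) → ℝ) (M : Matrix ↥(boxDom (N0 ℓ Mh k P)) ↥(boxDom (N0 ℓ Mh k P)) ℝ) :
    ((r : ℝ) : ℂ) • (Matrix.of fun x x' => ω x * M x x').map ((↑) : ℝ → ℂ) =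
      (Matrix.of fun x x' => (r * ω x) * M x x').map ((↑) : ℝ → ℂ) := by
  ext x y; simp only [Matrix.smul_apply, Matrix.map_apply, Matrix.of_apply, smul_eq_mul]; push_cast; ring

/-- **THE LEVEL-WEIGHTED LETTERS OF THE MULTI-LEVEL FLAT PROPAGATOR** (print's (3.42) «O(1)[(L^jη)², (L^jη)]» EXACTLY): ∃ `δ₁, C, M₀, N₀`
(d, ℓ, windows only) such that for every admissible datum, with `W = η²(G′.map ofReal)`, `w = L^{k−lev}`, `∇c_μ ⊗ 1 = Dfw μ`:
`‖W ⊗ 1‖_{Y,Y′} ≤ Ce^{−δ₁d₁}`, `‖(w² ⊗ 1)(W ⊗ 1)‖_{Y,Y′} ≤ Ce^{−δ₁d₁}`, `‖(w ⊗ 1)(∇c_μ ⊗ 1)(W ⊗ 1)‖_{Y,Y′} ≤ Ce^{−δ₁d₁}`.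
[cite: Balaban1984PropagatorsII, Prop. 2.2 (2.67) p.234, Lemma 2.1 (2.61) p.234; Balaban1985BackgroundPropagators, Thm 3.1 (3.42) p.397] -/
theorem weightedLetters_multiLevelTorus (d ℓ : ℕ) (hℓ : 1 ≤ ℓ) (aminus aplus a2minus a2plus : ℝ) (ha : 0 < aminus)
    (ha2 : 0 < a2minus) :
    ∃ δ₁ C M₀ : ℝ, ∃ N₀ : ℕ, 0 < δ₁ ∧ 0 < C ∧ 0 < M₀ ∧ 0 < N₀ ∧
      ∀ (k Mh R : ℕ), 3 ≤ Mh → M₀ ≤ ((ℓ : ℝ) + 1) * Mh → 2 * (ℓ + 1) ≤ R → N₀ + 1 ≤ R * ((ℓ + 1) * Mh) →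
      ∀ (P : Fin (d + 1) → ℕ) (hP : ∀ μ, 1 ≤ P μ) (hP4 : ∀ μ, 4 ≤ P μ) (D : TDomains d ℓ Mh k P R) (a c : ℕ → ℝ),
        (∀ i, 1 ≤ i → aminus ≤ a i ∧ a i ≤ aplus) → (∀ i, 1 ≤ i → a2minus ≤ c i ∧ c i ≤ a2plus) →
        (∀ i, 1 ≤ i → a (i + 1) = aNext ℓ (a i) (c i)) →
      ∀ (Kc : Fin (d + 1) → ℕ) [∀ i, NeZero (Kc i)], (∀ i, N0 ℓ Mh k P i = (ℓ + 1) ^ k * Kc i) →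
      ∀ (F : Type) [Fintype F] [DecidableEq F], ∀ Y Y' : UT Kc,
        blockNorm (fun q : ↥(boxDom (N0 ℓ Mh k P)) × F => cubeML ℓ k Kc q.1.1) (fun q => cubeML ℓ k Kc q.1.1)
            (Matrix.blockDiagonal fun _ : F =>
              ((((ℓ : ℂ) + 1) ^ (2 * k))⁻¹ : ℂ) • (gmlT (N0 ℓ Mh k P) ℓ k D.lev a).map ((↑) : ℝ → ℂ)) Y Y' ≤
          C * Real.exp (-(δ₁ * tdist1 Kc Y Y')) ∧
        blockNorm (fun q : ↥(boxDom (N0 ℓ Mh k P)) × F => cubeML ℓ k Kc q.1.1) (fun q => cubeML ℓ k Kc q.1.1)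
            (wOp ↥(boxDom (N0 ℓ Mh k P)) F (fun x => levW D x ^ 2) * Matrix.blockDiagonal fun _ : F =>
              ((((ℓ : ℂ) + 1) ^ (2 * k))⁻¹ : ℂ) • (gmlT (N0 ℓ Mh k P) ℓ k D.lev a).map ((↑) : ℝ → ℂ)) Y Y' ≤
          C * Real.exp (-(δ₁ * tdist1 Kc Y Y')) ∧
        ∀ μ : Fin (d + 1),
          blockNorm (fun q : ↥(boxDom (N0 ℓ Mh k P)) × F => cubeML ℓ k Kc q.1.1) (fun q => cubeML ℓ k Kc q.1.1)
              (wOp ↥(boxDom (N0 ℓ Mh k P)) F (levW D) *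
                (Dfw ↥(boxDom (N0 ℓ Mh k P)) F (fun ν => tshift (N0 ℓ Mh k P) (unitVec ν)) ((((ℓ : ℝ) + 1) ^ k)⁻¹) μ *
                  Matrix.blockDiagonal fun _ : F =>
                    ((((ℓ : ℂ) + 1) ^ (2 * k))⁻¹ : ℂ) • (gmlT (N0 ℓ Mh k P) ℓ k D.lev a).map ((↑) : ℝ → ℂ))) Y Y' ≤
            C * Real.exp (-(δ₁ * tdist1 Kc Y Y')) := by
  obtain ⟨δa, Ca, Ma, Na, hδa, hCa, hMa, hNa, hA⟩ := prop22_first_multiLevelTorus d ℓ hℓ aminus aplus a2minus a2plus ha ha2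
  obtain ⟨δb, Cb, Mb, Nb, hδb, hCb, hMb, hNb, hB⟩ :=
    prop22_second_multiLevelTorus d ℓ hℓ aminus aplus a2minus a2plus ha ha2
  have hL0 : (0 : ℝ) < (ℓ : ℝ) + 1 := by positivity
  have hL1 : (1 : ℝ) ≤ (ℓ : ℝ) + 1 := by linarith [(Nat.cast_nonneg ℓ : (0 : ℝ) ≤ ℓ)]
  set δ : ℝ := min δa δb with hδ
  have hδpos : 0 < δ := lt_min hδa hδb
  set Nc : ℕ := ⌈4 * ((d : ℝ) + 1) * ((ℓ : ℝ) + 1) / (1 / 2 * (δ / 2))⌉₊ + 1 with hNc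
  have hNcpos : 0 < Nc := by rw [hNc]; omega
  have hθlt : Real.exp (-(1 / 2 * (δ / 2))) * ((ℓ : ℝ) + 1) ^ ((2 * (d + 1 : ℕ) : ℝ) / Nc) < 1 := by
    refine theta_lt_one_of_log hL0 hNcpos ?_
    have hlog : Real.log ((ℓ : ℝ) + 1) ≤ (ℓ : ℝ) + 1 := (Real.log_le_sub_one_of_pos hL0).trans (by linarith)
    have hNcge : 4 * ((d : ℝ) + 1) * ((ℓ : ℝ) + 1) / (1 / 2 * (δ / 2)) < (Nc : ℝ) := by
      rw [hNc]; push_cast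
      exact lt_of_le_of_lt (Nat.le_ceil _) (by linarith)
    have hσ : (0 : ℝ) < 1 / 2 * (δ / 2) := by positivity
    rw [div_lt_iff₀ hσ] at hNcge
    push_cast
    nlinarith [mul_nonneg (by positivity : (0 : ℝ) ≤ 2 * ((d : ℝ) + 1)) (Real.log_nonneg hL1)]
  set c₁ : ℝ := K261 Nc (d + 1) ((ℓ : ℝ) + 1) 1 (1 / 2 * (δ / 2)) with hc₁
  have hc₁0 : 0 ≤ c₁ := K261_nonneg (by positivity) zero_le_one
  refine ⟨δ / 2 / 2 / ((d : ℝ) + 1), max Ca Cb * c₁ + 1, max Ma Mb, max Na (max Nb Nc), by positivity, by positivity,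
    lt_max_iff.2 (Or.inl hMa), lt_max_iff.2 (Or.inl hNa), ?_⟩
  intro k Mh R hMh hM hR hRM P hP hP4 D a c haw hcw hac Kc _ hKc F _ _ Y Y'
  have hMh1 : 1 ≤ Mh := le_trans (by norm_num) hMh
  have hMa' : Ma ≤ ((ℓ : ℝ) + 1) * Mh := (le_max_left _ _).trans hM
  have hMb' : Mb ≤ ((ℓ : ℝ) + 1) * Mh := (le_max_right _ _).trans hM
  have hN1 := Nat.le_max_left Na (max Nb Nc)
  have hN2 := Nat.le_max_right Na (max Nb Nc)
  have hN3 := Nat.le_max_left Nb Nc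
  have hN4 := Nat.le_max_right Nb Nc
  have hNa' : Na + 1 ≤ R * ((ℓ + 1) * Mh) := by omega
  have hNb' : Nb + 1 ≤ R * ((ℓ + 1) * Mh) := by omega
  have hNc' : Nc + 1 ≤ R * ((ℓ + 1) * Mh) := by omega
  obtain ⟨-, h261, -, -⟩ := lemma21_torus D hMh1 hP hNcpos hNc' (δ₀ := δ / 2) (α := 1 / 2) (by positivity)
    (by norm_num) (by norm_num) hθlt
  have hdnn : ∀ y y' : (geomT D).Site, 0 ≤ (geomT D).dist y y' := (triangle_refl_nonneg_T D hMh1 hP).2.2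
  have hrate : ∀ {δ' : ℝ}, δ ≤ δ' → ∀ y y' : (geomT D).Site,
      Real.exp (-(δ' / 2 * (geomT D).dist y y')) ≤ Real.exp (-(δ / 2 * (geomT D).dist y y')) := by
    intro δ' hδ' y y'
    rw [Real.exp_le_exp, neg_le_neg_iff]
    exact mul_le_mul_of_nonneg_right (by linarith) (hdnn y y')
  have hGmaj : HasMajorant (g := geomT D) (blkOf D.toDomains) (Matrix.toLin' (gmlT (N0 ℓ Mh k P) ℓ k D.lev a))
      (fun y y' => (Ca * ((ℓ : ℝ) + 1) ^ (2 * y.1.1)) * Real.exp (-(δ / 2 * (geomT D).dist y y'))) :=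
    hasMajorant_mono (blkOf D.toDomains) (hA k Mh R hMh hMa' hR hNa' P hP hP4 D a c haw hcw hac) fun y y' =>
      mul_le_mul_of_nonneg_left (hrate (min_le_left _ _) y y') (by positivity)
  have hDmaj : ∀ μ, HasMajorant (g := geomT D) (blkOf D.toDomains)
      (Matrix.toLin' (dT (N0 ℓ Mh k P) μ * gmlT (N0 ℓ Mh k P) ℓ k D.lev a))
      (fun y y' => (Cb * ((ℓ : ℝ) + 1) ^ y.1.1) * Real.exp (-(δ / 2 * (geomT D).dist y y'))) := fun μ =>
    hasMajorant_mono (blkOf D.toDomains) (hB k Mh R hMh hMb' hR hNb' P hP hP4 D a c haw hcw hac μ) fun y y' =>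
      mul_le_mul_of_nonneg_left (hrate (min_le_right _ _) y y') (by positivity)
  have hexp0 : 0 ≤ Real.exp (-(δ / 2 / 2 / ((d : ℝ) + 1) * tdist1 Kc Y Y')) := (Real.exp_pos _).le
  have hCa' : Ca * c₁ ≤ max Ca Cb * c₁ + 1 := by nlinarith [le_max_left Ca Cb]
  have hCb' : Cb * c₁ ≤ max Ca Cb * c₁ + 1 := by nlinarith [le_max_right Ca Cb]
  -- the level of a site's block is the site's level
  have hlevblk : ∀ x : ↥(boxDom (N0 ℓ Mh k P)), (blkOf D.toDomains x).1.1 = D.lev x.1 := fun x => rfl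
  have hlevle : ∀ x : ↥(boxDom (N0 ℓ Mh k P)), D.lev x.1 ≤ k := fun x => D.lev_le x.1
  -- the real scalar `L^{−2k}` and its complexification
  have hcast2 : ((((((ℓ : ℝ) + 1) ^ (2 * k))⁻¹ : ℝ)) : ℂ) = ((((ℓ : ℂ) + 1) ^ (2 * k))⁻¹ : ℂ) := by push_cast; ring
  refine ⟨?_, ?_, fun μ => ?_⟩
  · -- value letter: weight L^{−2k} ≤ L^{−2 lev}
    rw [← hcast2, show ((((((ℓ : ℝ) + 1) ^ (2 * k))⁻¹ : ℝ)) : ℂ) • (gmlT (N0 ℓ Mh k P) ℓ k D.lev a).map ((↑) : ℝ → ℂ) =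
        (Matrix.of fun x x' => ((((ℓ : ℝ) + 1) ^ (2 * k))⁻¹ * 1) * gmlT (N0 ℓ Mh k P) ℓ k D.lev a x x').map ((↑) : ℝ → ℂ) from by
          ext x y; simp only [Matrix.smul_apply, Matrix.map_apply, Matrix.of_apply, smul_eq_mul]; push_cast; ring]
    refine (blockNorm_blockDiagonal_le (fun x : ↥(boxDom (N0 ℓ Mh k P)) => cubeML ℓ k Kc x.1) _ Y Y').trans ?_
    refine (blockNorm_rowWeighted_le (D := D) hMh1 hP hKc _ (Fw := Ca) (by positivity) hCa.le hc₁0 (fun y => by positivity)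
      (fun _ => (((ℓ : ℝ) + 1) ^ (2 * k))⁻¹ * 1) (fun _ => by positivity) (fun x => ?_) hGmaj h261 Y Y').trans
      (mul_le_mul_of_nonneg_right hCa' hexp0)
    rw [hlevblk]
    have hpow : ((ℓ : ℝ) + 1) ^ (2 * D.lev x.1) ≤ ((ℓ : ℝ) + 1) ^ (2 * k) := pow_le_pow_right₀ hL1 (by have := hlevle x; omega)
    have hpk : (0 : ℝ) < ((ℓ : ℝ) + 1) ^ (2 * k) := by positivity
    calc (((ℓ : ℝ) + 1) ^ (2 * k))⁻¹ * 1 * (Ca * ((ℓ : ℝ) + 1) ^ (2 * D.lev x.1))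
        = Ca * (((ℓ : ℝ) + 1) ^ (2 * D.lev x.1) / ((ℓ : ℝ) + 1) ^ (2 * k)) := by field_simp
      _ ≤ Ca * 1 := mul_le_mul_of_nonneg_left ((div_le_one hpk).2 hpow) hCa.le
      _ = Ca := mul_one _
  · -- weighted value letter: w² · L^{−2k} · Ca L^{2 lev} = Ca
    rw [wOp_mul_blockDiagonal, ← hcast2, real_smul_of_mul_map]
    refine (blockNorm_blockDiagonal_le (fun x : ↥(boxDom (N0 ℓ Mh k P)) => cubeML ℓ k Kc x.1) _ Y Y').trans ?_
    refine (blockNorm_rowWeighted_le (D := D) hMh1 hP hKc _ (Fw := Ca) (by positivity) hCa.le hc₁0 (fun y => by positivity)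
      (fun x => (((ℓ : ℝ) + 1) ^ (2 * k))⁻¹ * levW D x ^ 2) (fun _ => by unfold levW; positivity) (fun x => le_of_eq ?_) hGmaj h261
      Y Y').trans (mul_le_mul_of_nonneg_right hCa' hexp0)
    have hk := hlevle x
    have hpk : ((ℓ : ℝ) + 1) ^ (2 * k) ≠ 0 := by positivity
    have e1 : (((ℓ : ℝ) + 1) ^ (k - D.lev x.1)) ^ 2 * ((ℓ : ℝ) + 1) ^ (2 * D.lev x.1) = ((ℓ : ℝ) + 1) ^ (2 * k) := by
      rw [← pow_mul, ← pow_add]; congr 1; omega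
    show (((ℓ : ℝ) + 1) ^ (2 * k))⁻¹ * levW D x ^ 2 * (Ca * ((ℓ : ℝ) + 1) ^ (2 * D.lev x.1)) = Ca
    unfold levW
    calc (((ℓ : ℝ) + 1) ^ (2 * k))⁻¹ * (((ℓ : ℝ) + 1) ^ (k - D.lev x.1)) ^ 2 * (Ca * ((ℓ : ℝ) + 1) ^ (2 * D.lev x.1))
        = Ca * (((((ℓ : ℝ) + 1) ^ (k - D.lev x.1)) ^ 2 * ((ℓ : ℝ) + 1) ^ (2 * D.lev x.1)) / ((ℓ : ℝ) + 1) ^ (2 * k)) := by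
          field_simp
      _ = Ca := by rw [e1, div_self hpk, mul_one]
  · -- weighted derivative letter: w · L^{k}L^{−2k} · Cb L^{lev} = Cb
    rw [Dfw_tshift_eq, blockDiagonal_smul_map_mul, wOp_mul_blockDiagonal]
    have hcast1 : ((((ℓ : ℂ) + 1) ^ k : ℂ) * ((((ℓ : ℂ) + 1) ^ (2 * k))⁻¹ : ℂ)) = ((((((ℓ : ℝ) + 1) ^ k)⁻¹ : ℝ)) : ℂ) := by
      have hL : ((ℓ : ℂ) + 1) ≠ 0 := by exact_mod_cast hL0.ne'
      push_cast
      rw [pow_mul', sq]; field_simp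
    rw [hcast1, real_smul_of_mul_map]
    refine (blockNorm_blockDiagonal_le (fun x : ↥(boxDom (N0 ℓ Mh k P)) => cubeML ℓ k Kc x.1) _ Y Y').trans ?_
    refine (blockNorm_rowWeighted_le (D := D) hMh1 hP hKc _ (Fw := Cb) (by positivity) hCb.le hc₁0 (fun y => by positivity)
      (fun x => (((ℓ : ℝ) + 1) ^ k)⁻¹ * levW D x) (fun _ => by unfold levW; positivity) (fun x => le_of_eq ?_) (hDmaj μ) h261
      Y Y').trans (mul_le_mul_of_nonneg_right hCb' hexp0)
    have hk := hlevle x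
    have hpk : ((ℓ : ℝ) + 1) ^ k ≠ 0 := by positivity
    have e1 : ((ℓ : ℝ) + 1) ^ (k - D.lev x.1) * ((ℓ : ℝ) + 1) ^ D.lev x.1 = ((ℓ : ℝ) + 1) ^ k := by
      rw [← pow_add]; congr 1; omega
    show (((ℓ : ℝ) + 1) ^ k)⁻¹ * levW D x * (Cb * ((ℓ : ℝ) + 1) ^ D.lev x.1) = Cb
    unfold levW
    calc (((ℓ : ℝ) + 1) ^ k)⁻¹ * ((ℓ : ℝ) + 1) ^ (k - D.lev x.1) * (Cb * ((ℓ : ℝ) + 1) ^ D.lev x.1)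
        = Cb * ((((ℓ : ℝ) + 1) ^ (k - D.lev x.1) * ((ℓ : ℝ) + 1) ^ D.lev x.1) / ((ℓ : ℝ) + 1) ^ k) := by field_simp
      _ = Cb := by rw [e1, div_self hpk, mul_one]

end Letters

end Summit.QuantumFields.BalabanUV.Gaps.D4WalkBlockWeightedLettersMultiLevel

end
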